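import Summits.QuantumFields.YangMills.Theorems.BalabanUVNodesPortS1Sect5OnDomainF1

/-!
# NODE O port, row PT-A-2 — F1′ REPAIR, PART 2: the AXIS-PERMUTATION on-domain rows of FILE `…Sect5PermOnAx`, the [B7] (53) NESTINGS of FILE `…Sect5RowsNumerics` and the gauge row
# from rows of FILE `…Sect5Ward`, RE-KEYED to the free-radius domain family `domAltOfRecord F N νD K j = {V | PlaqSmall νD.ε₀ V}` (the Federbush guard now reads
# `((dL)²∕4)·νD.ε₀ < δ_Fed`, the nestings `2ε ≤ νD.ε₀·L²`)

CITATION HEADER.  [I] = [Balaban1987RG1]: (1.6) p. 261, (1.19) p. 263, (2.9) p. 266, (2.16)–(2.18) p. 269, (1.2) p. 260, (0.11) p. 253, (2.3) p. 265; [B11] = [Balaban1985Variational]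
Thm 1 p. 279; [B7] = [Balaban1985Averaging] Prop. 2 (53) p. 26.  Porter PT-A-2 (`ymgap-nodeO-port-PTA-2`), `--supports stmt-QuantumFields-27930 --as helper`.
WHY THE RE-KEYING IS SOUND.  The re-centred cut-off `chiβOfRecord₁₃Ax F N θ₀ = chiFixed29Ax F N θ₀.ν θ₀.ε₂₉` reads the numerics `θ₀.ν` ONLY through `critCfgOfRecord F N θ₀.ν`, i.e. through
the regularity radius `θ₀.ν.εreg` of [B11]'s minimiser (`SmallFieldChi29OfRecord` :77, `SmallFieldChi29AxOfRecord` :59∕:142∕:147); the DOMAINS on which gen 2∕3 asked gauge ∕ Euclidean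
invariance, [B11] existence–uniqueness, (F7a), (F7a-supp) and the nestings are a SEPARATE datum — dag-n09-w4's engine `invOn_effActionHT_of_stepsOn_on` takes an arbitrary open,
gauge-stable family `D`.  Every proof below is the gen-2∕3 proof VERBATIM with `domAltOfRecord F N θ₀.ν ↦ domAltOfRecord F N νD` in the domain slots (the radius `θ₀.ν.εreg` of the
[B11] rows and `critCfgOfRecord F N θ₀.ν` are untouched); the numeric guards now read `νD.ε₀` (`0 ≤ νD.ε₀`, `((dL)²∕4)·νD.ε₀ < δ_Fed`, `2ε ≤ νD.ε₀·L²`), all satisfiable for small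
`νD.ε₀`.  At `θ₀ := thetaFill F a₀ ε₂₉` the originals' radius `θ₀.ν.ε₀` is PINNED TO THE LITERAL `1` (a `Φf`-unread fill) and the Federbush clause is false (referee ref-H F1,
2026-08-31): the originals stay in the tree (true, vacuous there, unused).
WHAT IS PROVED (0 sorry, 0 def): `chiβOfRecord₁₃Ax_permute_of_mem_domAlt'`, `invOn_effActionHT_recordAx_permute'`, `mergedTermT_permute_on_recordAx'` ([I] (2.17), Federbush admissibility on
`{PlaqSmall νD.ε₀}`); `nestings_of_numerics'` ([B7] (53): `V^{(j)}(W) ∈ {PlaqSmall νD.ε₀}_j`, `Ū^k U_{k+1}(W) ∈ {PlaqSmall νD.ε₀}_k`); `mergedTermT_gaugeAct_recordAx_of_rows'`.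
HONEST FRAMING.  A re-keying of displayed rows (bookkeeping over dag-n09's engines); nothing of Bałaban's estimates asserted, ported or discharged; the rows REMAIN displayed (N-lane ∕ [B11]
suppliers); 27930 signed-open (⁸-Ax-LR4), no claim held; finite 𝕋⁴ at fixed ε — NOT continuum∕OS∕Clay; the Yang–Mills mass gap is NOT proved by any of this.
-/

noncomputable section

open scoped Matrix.Norms.L2Operator Topology

namespace Summit.QuantumFields.YangMills.Theorems.BalabanUVNodesPortS1

open Filter MeasureTheory
open Literature.MathematicalPhysics.QuantumFieldTheory.Balaban1983to89
open Literature.MathematicalPhysics.QuantumFieldTheory.Balaban1983to89.Node00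
open Literature.MathematicalPhysics.QuantumFieldTheory.Balaban1983to89.ExpMeanLog (deltaSU)
open T4Continuum (T4Family)
open B12Eq019ActionBody (integrand integrand_apply wilsonTerm_apply)
open B12RTGaugeInvariance254 (liftTransf)
open GaugeField (gaugeAct)
open B12ContinuousTransportInvarianceOn (isOpen_domAltOfRecord domAltOfRecord_gaugeAct_mem)
open Summit.QuantumFields.YangMills.BalabanUVNodes.N09AtRecord13SepCoPHOnDomains (invOn_effActionHT_of_stepsOn_on stepOn_TβOfRecord₁₃_of_subset_regSet_inter_of_on
  domAltOfRecord_gaugeAct_mem_iff integrand_comp_liftAct_ae_eq_on_of_invOn)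
open B16Sect1Backgrounds (iter_gaugeAct gaugeAct_gaugeAct)
open Literature.MathematicalPhysics.QuantumFieldTheory.Balaban1983to89.Node00.ZeroInput (stepOutT mergedTermT_eq_stepOut)
open BlockAveragingTwoLevel (stairHol offsetOf)
open FederbushMean (federbushSU deltaFed)
open Summit.QuantumFields.YangMills.BalabanUVNodes.N09GaugeFixingTermContinuousOnAdmissible (adm_stairHol_of_plaqSmall)
open Summit.QuantumFields.YangMills.BalabanUVNodes.N09NestingOfHierAxial (hcrit_of_ukExists iterUk_mem_domAlt_of_ukExists)

section General

variable {F : T4Family} {N : ℕ} [NeZero N]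

section Rows

variable (θ₀ : Stage13Params F N) (νD : Stage7Numerics) (K : ℕ) (g : ℕ → ℝ)

/-! ## §1 Axis permutations on the free-radius domains (twins of FILE `…Sect5PermOnAx` §2–§3) -/

/-- **[F1′ twin: the small-field DOMAIN family is `domAltOfRecord F · νD K ·` = `{PlaqSmall νD.ε₀}` for a FREE numerics record `νD` (only `νD.ε₀` is read); χ, radii `ν.εreg`∕`εbg`∕`ε₂₉` unchanged]** **`χ^{Ax}_j(πU) = χ^{Ax}_j(U)`** for every `U` whose average lies in the small-field domain of level `j+1` (permutation-stable), given [B11] Thm 1 on that domain at the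
cut-off's radius, the NESTING row «`V^{(j)}(W) ∈ domAlt_j` for `W ∈ domAlt_{j+1}`» and the numeric guard (FILE E2's row fed at `Ū` and `πŪ`, its admissibility clause
discharged on the domain). [cite: Balaban1987RG1, (2.17) p.269, (2.9) p.266, (2.3) p.265, (0.11) p.253; Balaban1985Variational, Thm 1 p.279] -/
theorem chiβOfRecord₁₃Ax_permute_of_mem_domAlt' {j : ℕ} (hj : j + 1 ≤ (F.P K).m + (F.P K).K) (hε : 0 ≤ νD.ε₀)
    (hnum : ((((F.P K).d * (F.P K).L : ℕ) : ℝ)) ^ 2 / 4 * νD.ε₀ < deltaFed (Fin N))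
    (h11 : ∀ W ∈ domAltOfRecord F N νD K (j + 1), UkExists F N K (j + 1) θ₀.ν.εreg W ∧ UniqueUkOrbit F N K (j + 1) θ₀.ν.εreg W)
    (hcrit : ∀ W ∈ domAltOfRecord F N νD K (j + 1), critCfgOfRecord F N θ₀.ν K j W ∈ domAltOfRecord F N νD K j)
    (π : Equiv.Perm (Fin (F.P K).d)) (U : GaugeField (F.P K) j (SU N)) (hU : (avOfRecord F N K j).avg U ∈ domAltOfRecord F N νD K (j + 1)) :
    chiβOfRecord₁₃Ax F N θ₀ K g j (U.permute π) = chiβOfRecord₁₃Ax F N θ₀ K g j U :=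
  chiFixed29Ax_permute_of_adm θ₀.ε₂₉ (Nat.le_of_succ_le hj) g π U (h11 _ hU).1
    (h11 _ ((mem_domAltOfRecord_iff F N νD K (j + 1) _).2
      ((B12RegularClassInvariance263.plaqSmall_permute_iff νD.ε₀ π _).2 ((mem_domAltOfRecord_iff F N νD K (j + 1) _).1 hU)))).2
    fun x => adm_stairHol_of_mem_domAlt K νD hj hε hnum (hcrit _ hU) (blockOf x) (Finset.mem_filter.2 ⟨Finset.mem_univ _, rfl⟩)

/-- **[F1′ twin: the small-field DOMAIN family is `domAltOfRecord F · νD K ·` = `{PlaqSmall νD.ε₀}` for a FREE numerics record `νD` (only `νD.ε₀` is read); χ, radii `ν.εreg`∕`εbg`∕`ε₂₉` unchanged]** **`A_k(πU) = A_k(U)` ON `domAlt_k`, all `k ≤ n ≤ K`, AT THE RE-CENTRED RECORD**, from [B11] Thm 1 on the domains (levels `< n`), (F7a), (F7a-supp), (I19), the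
NESTING row «`V^{(j)}(W) ∈ domAlt_j`» (levels `< n`) and the numeric guard. [cite: Balaban1987RG1, p.263, (2.17) p.269, (0.13) p.254, (0.19) p.255, (0.11) p.253; Balaban1985Variational, Thm 1 p.279] -/
theorem invOn_effActionHT_recordAx_permute' {n : ℕ} (hn : n ≤ K) (π : Equiv.Perm (Fin (F.P K).d)) (hε : 0 ≤ νD.ε₀)
    (hnum : ((((F.P K).d * (F.P K).L : ℕ) : ℝ)) ^ 2 / 4 * νD.ε₀ < deltaFed (Fin N))
    (h11 : ∀ j < n, ∀ W ∈ domAltOfRecord F N νD K (j + 1), UkExists F N K (j + 1) θ₀.ν.εreg W ∧ UniqueUkOrbit F N K (j + 1) θ₀.ν.εreg W)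
    (hcrit : ∀ j < n, ∀ W ∈ domAltOfRecord F N νD K (j + 1), critCfgOfRecord F N θ₀.ν K j W ∈ domAltOfRecord F N νD K j)
    (hF7a : ∀ j < n, domAltOfRecord F N νD K (j + 1) ⊆
      regSetOfRecord F N K j (betaInputOfRecord F N (TβOfRecord₁₃ F N) (chiβOfRecord₁₃Ax F N θ₀) K g j))
    (hsupp : ∀ j < n, ∀ᵐ U ∂(fieldMeasure (F.P K) j (SU N)), (avOfRecord F N K j).avg U ∈ domAltOfRecord F N νD K (j + 1) →
      U ∉ domAltOfRecord F N νD K j → chiβOfRecord₁₃Ax F N θ₀ K g j U = 0)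
    (hint : ∀ j < n, Integrable (betaInputOfRecord F N (TβOfRecord₁₃ F N) (chiβOfRecord₁₃Ax F N θ₀) K g j) (fieldMeasure (F.P K) j (SU N))) :
    ∀ k ≤ n, ∀ U, U ∈ domAltOfRecord F N νD K k →
      effActionHT F N (TβOfRecord₁₃ F N) (chiβOfRecord₁₃Ax F N θ₀) K g k (U.permute π) =
        effActionHT F N (TβOfRecord₁₃ F N) (chiβOfRecord₁₃Ax F N θ₀) K g k U := by
  have hn' : n ≤ (F.P K).m + (F.P K).K := hn.trans (by simp only [T4Continuum.T4Family.P_K]; omega)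
  have h := invOn_effActionHT_of_stepsOn_family_on F N (TβOfRecord₁₃ F N) (chiβOfRecord₁₃Ax F N θ₀) K g n
    (fun j => domAltOfRecord F N νD K j) (fun j => domAltOfRecord F N νD K j) (I := fun _ => Equiv.Perm (Fin (F.P K).d)) (fun _ π' => π')
    (fun _ π' U => U.permute π')
    (fun π' U => (wilsonAction_invariant_generators F N (K := K) 1).2.1 π' U) (fun j hj π' => ?_) hsupp (fun j hj π' U hU => ?_)
    (fun j hj π' hρ V hV => ?_)
  · exact fun k hk U hU => h k hk π U hU
  · have hj' : j + 1 ≤ (F.P K).m + (F.P K).K := (Nat.succ_le_of_lt hj).trans hn'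
    exact Filter.Eventually.of_forall fun U hU => chiβOfRecord₁₃Ax_permute_of_mem_domAlt' θ₀ νD K g hj' hε hnum (h11 j hj) (hcrit j hj) π' U hU
  · have hj' : j + 1 ≤ (F.P K).m + (F.P K).K := (Nat.succ_le_of_lt hj).trans hn'
    exact gfOfRecord_permute_of_mem_domAlt K νD hj' hε hnum π' U hU
  · exact TcanOfRecord_permute_of_mem_regSet_inter_of_on (lt_of_lt_of_le hj hn) (hint j hj) π' (isOpen_domAltOfRecord νD K (j + 1))
      (fun W => permute_mem_domAltOfRecord_iff K νD (j + 1) π' W) hρ ⟨hF7a j hj hV, hV⟩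

/-- **[F1′ twin: the small-field DOMAIN family is `domAltOfRecord F · νD K ·` = `{PlaqSmall νD.ε₀}` for a FREE numerics record `νD` (only `νD.ε₀` is read); χ, radii `ν.εreg`∕`εbg`∕`ε₂₉` unchanged]** **★ `𝓝_{k+1}(πW) = 𝓝_{k+1}(W)` AT THE RE-CENTRED RECORD for `W ∈ domAlt_{k+1}`** (`k + 1 ≤ K`): rows — [B11] on the domains (levels `≤ k+1`, radius `ν.εreg`), (F7a) at
levels `≤ k`, (F7a-supp), (I19), the NESTING rows «`Ū^k U_{k+1}(W) ∈ domAlt_k`» (radius `ε`) and «`V^{(j)}(W′) ∈ domAlt_j` for `W′ ∈ domAlt_{j+1}`, `j ≤ k`» (radius `ν.εreg`),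
[B11] at `W`, `πW` (radius `ε`), and the numeric guard `0 ≤ ν.ε₀`, `((d·L)²∕4)·ν.ε₀ < δ_N`; the `A_k`-rows on `domAlt_k` (gauge: FILE `…Sect5GaugeOn` §2 with (F7a);
permutation: §2) are discharged inside. [cite: Balaban1987RG1, (1.6) p.261, (2.17) p.269, p.263, (1.2) p.260, (0.11) p.253; Balaban1985Variational, Thm 1 p.279] -/
theorem mergedTermT_permute_on_recordAx' (ε : ℝ) {k : ℕ} (hk : k + 1 ≤ K) (π : Equiv.Perm (Fin (F.P K).d)) (hε : 0 ≤ νD.ε₀)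
    (hnum : ((((F.P K).d * (F.P K).L : ℕ) : ℝ)) ^ 2 / 4 * νD.ε₀ < deltaFed (Fin N))
    (h11 : ∀ j < k + 1, ∀ W ∈ domAltOfRecord F N νD K (j + 1), UkExists F N K (j + 1) θ₀.ν.εreg W ∧ UniqueUkOrbit F N K (j + 1) θ₀.ν.εreg W)
    (hcrit : ∀ j < k + 1, ∀ W ∈ domAltOfRecord F N νD K (j + 1), critCfgOfRecord F N θ₀.ν K j W ∈ domAltOfRecord F N νD K j)
    (hF7a : ∀ j < k + 1, domAltOfRecord F N νD K (j + 1) ⊆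
      regSetOfRecord F N K j (betaInputOfRecord F N (TβOfRecord₁₃ F N) (chiβOfRecord₁₃Ax F N θ₀) K g j))
    (hsupp : ∀ j < k + 1, ∀ᵐ U ∂(fieldMeasure (F.P K) j (SU N)), (avOfRecord F N K j).avg U ∈ domAltOfRecord F N νD K (j + 1) →
      U ∉ domAltOfRecord F N νD K j → chiβOfRecord₁₃Ax F N θ₀ K g j U = 0)
    (hint : ∀ j < k + 1, Integrable (betaInputOfRecord F N (TβOfRecord₁₃ F N) (chiβOfRecord₁₃Ax F N θ₀) K g j) (fieldMeasure (F.P K) j (SU N)))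
    {W : GaugeField (F.P K) (k + 1) (SU N)} (hWD : W ∈ domAltOfRecord F N νD K (k + 1))
    (hnest : Averaging.iter (avOfRecord F N K) k (Uk F N K (k + 1) ε W) ∈ domAltOfRecord F N νD K k)
    (hW : UkExists F N K (k + 1) ε W) (hu : UniqueUkOrbit F N K (k + 1) ε (W.permute π)) :
    mergedTermT F N (TβOfRecord₁₃ F N) (chiβOfRecord₁₃Ax F N θ₀) ε K g k (W.permute π) =
      mergedTermT F N (TβOfRecord₁₃ F N) (chiβOfRecord₁₃Ax F N θ₀) ε K g k W := by
  have hk' : k + 1 ≤ (F.P K).m + (F.P K).K := hk.trans (by simp only [T4Continuum.T4Family.P_K]; omega)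
  have hAπ := invOn_effActionHT_recordAx_permute' θ₀ νD K g hk π hε hnum h11 hcrit hF7a hsupp hint
  -- the gauge row of `A_k` on `domAlt_k`: FILE `…Sect5GaugeOn` §2 gives it on `regSet_{k−1} ∩ domAlt_k`, which is `domAlt_k` under (F7a)
  have hAg : ∀ (w : GaugeTransf (F.P K) k (SU N)) (U : GaugeField (F.P K) k (SU N)), U ∈ domAltOfRecord F N νD K k →
      effActionHT F N (TβOfRecord₁₃ F N) (chiβOfRecord₁₃Ax F N θ₀) K g k (gaugeAct w U) = effActionHT F N (TβOfRecord₁₃ F N) (chiβOfRecord₁₃Ax F N θ₀) K g k U := by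
    intro w U hU
    have hχreg : ∀ i, i + 1 < k + 1 → ∀ᵐ U ∂(fieldMeasure (F.P K) (i + 1) (SU N)),
        (avOfRecord F N K (i + 1)).avg U ∈ domAltOfRecord F N νD K (i + 2) →
          U ∉ regSetOfRecord F N K i (betaInputOfRecord F N (TβOfRecord₁₃ F N) (chiβOfRecord₁₃Ax F N θ₀) K g i) ∩ domAltOfRecord F N νD K (i + 1) →
            chiβOfRecord₁₃Ax F N θ₀ K g (i + 1) U = 0 := fun i hi =>
      (hsupp (i + 1) hi).mono fun U h hS hD => h hS fun hU' => hD ⟨hF7a i (by omega) hU', hU'⟩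
    have hA := invOn_effActionHT_recordAx_of_stepsOn' θ₀ νD K g hk h11 hχreg hint k (Nat.le_succ k) w U
    cases k with
    | zero => exact hA (Set.mem_univ _)
    | succ i => exact hA ⟨hF7a i (by omega) hU, hU⟩
  -- the image row at level `k` on `domAlt_{k+1}`: the density `ρ_k` is `π`-invariant a.e. over the fibres of the domain
  have hρ : ∀ᵐ U ∂(fieldMeasure (F.P K) k (SU N)), (avOfRecord F N K k).avg U ∈ domAltOfRecord F N νD K (k + 1) →
      betaInputOfRecord F N (TβOfRecord₁₃ F N) (chiβOfRecord₁₃Ax F N θ₀) K g k (U.permute π) =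
        betaInputOfRecord F N (TβOfRecord₁₃ F N) (chiβOfRecord₁₃Ax F N θ₀) K g k U :=
    integrand_comp_ae_eq_on_of_invOn
      (Filter.Eventually.of_forall fun U hU => chiβOfRecord₁₃Ax_permute_of_mem_domAlt' θ₀ νD K g hk' hε hnum (h11 k (Nat.lt_succ_self k))
        (hcrit k (Nat.lt_succ_self k)) π U hU)
      (hsupp k (Nat.lt_succ_self k)) (fun U hU => gfOfRecord_permute_of_mem_domAlt K νD hk' hε hnum π U hU)
      (fun U hU => hAπ k (Nat.le_succ k) U hU) (g k)
  have hTon : ∀ V : GaugeField (F.P K) (k + 1) (SU N), V ∈ domAltOfRecord F N νD K (k + 1) →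
      TβOfRecord₁₃ F N K k (betaInputOfRecord F N (TβOfRecord₁₃ F N) (chiβOfRecord₁₃Ax F N θ₀) K g k) (V.permute π) =
        TβOfRecord₁₃ F N K k (betaInputOfRecord F N (TβOfRecord₁₃ F N) (chiβOfRecord₁₃Ax F N θ₀) K g k) V := fun V hV =>
    TcanOfRecord_permute_of_mem_regSet_inter_of_on hk (hint k (Nat.lt_succ_self k)) π (isOpen_domAltOfRecord νD K (k + 1))
      (fun W => permute_mem_domAltOfRecord_iff K νD (k + 1) π W) hρ ⟨hF7a k (Nat.lt_succ_self k) hV, hV⟩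
  exact mergedTermT_permute_on F N (TβOfRecord₁₃ F N) (chiβOfRecord₁₃Ax F N θ₀) ε g hk' π hTon hAg
    (fun U hU => (permute_mem_domAltOfRecord_iff K νD k π U).2 hU) (fun U hU => hAπ k (Nat.le_succ k) U hU) hWD hnest hW hu

end Rows

end General

/-! ## §2 `N = 2`: the nestings and the gauge row from rows (twins of FILES `…Sect5RowsNumerics`, `…Sect5Ward`) -/

section Two

variable (F : T4Family)

/-- **[F1′ twin: the small-field DOMAIN family is `domAltOfRecord F · νD K ·` = `{PlaqSmall νD.ε₀}` for a FREE numerics record `νD` (only `νD.ε₀` is read); χ, radii `ν.εreg`∕`εbg`∕`ε₂₉` unchanged]** **THE TWO NESTING ROWS FROM [B11] EXISTENCE + NUMERICS** ([B7] Prop. 2 (53) at NODE 00's averaging, dag-n21-c ∕ dag-n09): for `W ∈ domAlt_{j+1}` solvable at radius `ν.εreg`,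
`V^{(j)}(W) = Ū^j U_{j+1}(W) ∈ domAlt_j`; for `W ∈ domAlt_{k+1}` solvable at radius `ε`, `Ū^k U_{k+1}(W) ∈ domAlt_k` — under `0 < ε`, `C₀(d)ε ≤ ⅓`, `2ε ≤ 2δ_N∕((d+4)L)²`, `2ε ≤ ε₀L²`
for `ε ∈ {ν.εreg, ε}`. [cite: Balaban1985Averaging, Prop. 2 (53) p.26; Balaban1987RG1, (2.3) p.265, (1.2) p.260] -/
theorem nestings_of_numerics' (θ₀ : Stage13Params F 2) (νD : Stage7Numerics) (K k : ℕ) {ε : ℝ}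
    (hεreg : 0 < θ₀.ν.εreg) (hreg3 : (143 * (((((F.P K).d + 4 : ℕ) : ℝ)) ^ 2 / 4) ^ 2) * θ₀.ν.εreg ≤ 1 / 3)
    (hreg2 : 2 * θ₀.ν.εreg ≤ 2 * deltaSU (Fin 2) / ((((F.P K).d + 4) * (F.P K).L : ℕ) : ℝ) ^ 2) (hregε₀ : 2 * θ₀.ν.εreg ≤ νD.ε₀ * ((F.P K).L : ℝ) ^ 2)
    (hε : 0 < ε) (hbg3 : (143 * (((((F.P K).d + 4 : ℕ) : ℝ)) ^ 2 / 4) ^ 2) * ε ≤ 1 / 3)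
    (hbg2 : 2 * ε ≤ 2 * deltaSU (Fin 2) / ((((F.P K).d + 4) * (F.P K).L : ℕ) : ℝ) ^ 2) (hbgε₀ : 2 * ε ≤ νD.ε₀ * ((F.P K).L : ℝ) ^ 2)
    (h11 : ∀ j < k + 1, ∀ W ∈ domAltOfRecord F 2 νD K (j + 1), UkExists F 2 K (j + 1) θ₀.ν.εreg W ∧ UniqueUkOrbit F 2 K (j + 1) θ₀.ν.εreg W)
    (htop : ∀ W ∈ domAltOfRecord F 2 νD K (k + 1), UkExists F 2 K (k + 1) ε W ∧ UniqueUkOrbit F 2 K (k + 1) ε W) :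
    (∀ j < k + 1, ∀ W ∈ domAltOfRecord F 2 νD K (j + 1), critCfgOfRecord F 2 θ₀.ν K j W ∈ domAltOfRecord F 2 νD K j) ∧
      ∀ W ∈ domAltOfRecord F 2 νD K (k + 1),
        Averaging.iter (avOfRecord F 2 K) k (Uk F 2 K (k + 1) ε W) ∈ domAltOfRecord F 2 νD K k ∧ UkExists F 2 K (k + 1) ε W ∧ UniqueUkOrbit F 2 K (k + 1) ε W :=
  ⟨fun j hj W hW => (mem_domAltOfRecord_iff F 2 νD K j _).2 (hcrit_of_ukExists θ₀.ν hεreg hreg3 hreg2 hregε₀ (h11 j hj W hW).1),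
    fun W hW => ⟨iterUk_mem_domAlt_of_ukExists νD hε hbg3 hbg2 hbgε₀ (htop W hW).1 (Nat.lt_succ_self k), htop W hW⟩⟩

/-- **[F1′ twin: the small-field DOMAIN family is `domAltOfRecord F · νD K ·` = `{PlaqSmall νD.ε₀}` for a FREE numerics record `νD` (only `νD.ε₀` is read); χ, radii `ν.εreg`∕`εbg`∕`ε₂₉` unchanged]** **`𝓝_{k+1}(W^w) = 𝓝_{k+1}(W)` FOR EVERY `ν.ε₀`-SMALL `W` AND EVERY LATTICE GAUGE TRANSFORMATION `w`, AT THE RE-CENTRED RECORD, from N09-shape rows** — FILE `…Sect5GaugeOn`'s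
`mergedTermT_gaugeAct_on_recordAx'` with its bookkeeping sets reduced to the small-field domains by (F7a) (the `hN` clause of `wardFirst_recordPlimAx_of_local` and of
`…Sect5GlobalRot`, from rows). [cite: Balaban1987RG1, (1.19) p.263, (2.16) p.269, p.263, (1.6) p.261; Balaban1985Variational, Thm 1 p.279] -/
theorem mergedTermT_gaugeAct_recordAx_of_rows' (θ₀ : Stage13Params F 2) (νD : Stage7Numerics) (ε : ℝ) (K : ℕ) (g : ℕ → ℝ) {k : ℕ} (hk : k + 1 ≤ K)
    (h11 : ∀ j < k + 1, ∀ W ∈ domAltOfRecord F 2 νD K (j + 1), UkExists F 2 K (j + 1) θ₀.ν.εreg W ∧ UniqueUkOrbit F 2 K (j + 1) θ₀.ν.εreg W)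
    (hF7a : ∀ j < k + 1, domAltOfRecord F 2 νD K (j + 1) ⊆
      regSetOfRecord F 2 K j (betaInputOfRecord F 2 (TβOfRecord₁₃ F 2) (chiβOfRecord₁₃Ax F 2 θ₀) K g j))
    (hsupp : ∀ j < k + 1, ∀ᵐ U ∂(fieldMeasure (F.P K) j (SU 2)), (avOfRecord F 2 K j).avg U ∈ domAltOfRecord F 2 νD K (j + 1) →
      U ∉ domAltOfRecord F 2 νD K j → chiβOfRecord₁₃Ax F 2 θ₀ K g j U = 0)
    (hint : ∀ j < k + 1, Integrable (betaInputOfRecord F 2 (TβOfRecord₁₃ F 2) (chiβOfRecord₁₃Ax F 2 θ₀) K g j) (fieldMeasure (F.P K) j (SU 2)))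
    (htop : ∀ W ∈ domAltOfRecord F 2 νD K (k + 1),
      Averaging.iter (avOfRecord F 2 K) k (Uk F 2 K (k + 1) ε W) ∈ domAltOfRecord F 2 νD K k ∧ UkExists F 2 K (k + 1) ε W ∧ UniqueUkOrbit F 2 K (k + 1) ε W)
    (w : GaugeTransf (F.P K) (k + 1) (SU 2)) (W : GaugeField (F.P K) (k + 1) (SU 2)) (hW : PlaqSmall νD.ε₀ W) :
    mergedTermT F 2 (TβOfRecord₁₃ F 2) (chiβOfRecord₁₃Ax F 2 θ₀) ε K g k (gaugeAct w W) =
      mergedTermT F 2 (TβOfRecord₁₃ F 2) (chiβOfRecord₁₃Ax F 2 θ₀) ε K g k W := by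
  have hWD : W ∈ domAltOfRecord F 2 νD K (k + 1) := (mem_domAltOfRecord_iff F 2 νD K (k + 1) W).2 hW
  have hχreg : ∀ i, i + 1 < k + 1 → ∀ᵐ U ∂(fieldMeasure (F.P K) (i + 1) (SU 2)),
      (avOfRecord F 2 K (i + 1)).avg U ∈ domAltOfRecord F 2 νD K (i + 2) →
        U ∉ regSetOfRecord F 2 K i (betaInputOfRecord F 2 (TβOfRecord₁₃ F 2) (chiβOfRecord₁₃Ax F 2 θ₀) K g i) ∩ domAltOfRecord F 2 νD K (i + 1) →
          chiβOfRecord₁₃Ax F 2 θ₀ K g (i + 1) U = 0 := fun i hi =>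
    (hsupp (i + 1) hi).mono fun U h hS hD => h hS fun hU' => hD ⟨hF7a i (by omega) hU', hU'⟩
  have hnest : Averaging.iter (avOfRecord F 2 K) k (Uk F 2 K (k + 1) ε W) ∈
      Nat.rec (motive := fun j => Set (GaugeField (F.P K) j (SU 2))) Set.univ
        (fun i _ => regSetOfRecord F 2 K i (betaInputOfRecord F 2 (TβOfRecord₁₃ F 2) (chiβOfRecord₁₃Ax F 2 θ₀) K g i) ∩ domAltOfRecord F 2 νD K (i + 1)) k := by
    cases k with
    | zero => exact Set.mem_univ _
    | succ i => exact ⟨hF7a i (by omega) (htop W hWD).1, (htop W hWD).1⟩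
  exact mergedTermT_gaugeAct_on_recordAx' θ₀ νD ε K g hk h11 hχreg hint w ⟨hF7a k (Nat.lt_succ_self k) hWD, hWD⟩ hnest (htop W hWD).2.1
    (htop _ (domAltOfRecord_gaugeAct_mem νD K (k + 1) w W hWD)).2.2

end Two

end Summit.QuantumFields.YangMills.Theorems.BalabanUVNodesPortS1

end
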